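import Summits.AtomisticToContinuum.Crystallization.Theses.DisclinationRation
import Summits.AtomisticToContinuum.Crystallization.Theorems.DisclinationRationFiveFoldRationDefs
import Summits.AtomisticToContinuum.Crystallization.Theorems.DisclinationRationFiveFoldRationFrontEnd
import Summits.AtomisticToContinuum.Crystallization.Theorems.DisclinationRationFiveFoldRationStubCubic

/-!
# Line `Sketch` — registered skeleton v7 for crux `DisclinationRation.FiveFoldRation`
# (item stmt-AtomisticToContinuum-15799, route DisclinationRation, sub-problem Crystallization)

Lead: prover-line-stmt-AtomisticToContinuum-15799-c1 (continuation of lead …-0, whose v6 left ONE open stub,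
`stub_dr5_core : IsAdmissible δ S → FrontEnd S → LayerInequality S`, judged crux-sized).

v7 RE-LINES that core along the strip forest of card sheet-area-strip-forest, in the NAMED sheet vocabulary appended
to `Theorems/DisclinationRationFiveFoldRationDefs.lean` (`IsFccLike`, `IsHcpLike`, `Equatorial`, `Straight`,
`sheetRel`, `colRel`, `HasRow`, `IsNarrow`, `SheetAxioms`, `StripForest`, `ChildLayerInequality`), so that
everything LOCAL or COMBINATORIAL becomes a provable stub and exactly ONE stub carries the global comparison
content:

* `stub_dr5_eqPattern`, `stub_dr5_eqRing`, `stub_dr5_fanPartner` — the local sheet axioms (A1)–(A7) from the landed front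
  end (links are pattern adjacency; pole lemma): layers read off links, hexagon antipodes, layers do not end at fcc
  sites, ring sites see their axis in-layer, one fan partner, ten ring sites.  Pattern-level finite combinatorics.
* `stub_dr5_engine` — `SheetAxioms S → StripForest S`: NO FLAT TUBE (fans of an axis lie in distinct sheets, no row
  returns to its column, column–sheet incidence oriented like a rooted forest).  This is the crux-sized global
  statement (developing map of the ideal octet complex `K(S) ≅ ℝ³` on a strip tube + `arccos(1/3)/π ∉ ℚ`); it is
  registered so that the disprover and a future engine seat have ONE typed target, and is expected to be PROMOTED.
* `stub_dr5_wide` — AREA: axis sites with a row of length `≥ W` are `O((1+ρ+κW)³/W)` in `B̄_ρ` (rows of distinct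
  (site, ring) pairs are told apart by their last in-layer edge: fibre `≤ 6`; volume by `stub_dr5_cubic`).
* `stub_dr5_narrow` — FOREST CHARGING: `W`-narrow axis sites in `B̄_ρ` are at most a quarter of the axis sites in
  `B̄_{ρ+κW}` (each narrow site charges `≥ 8` short rows into child sheets to their end sites, each end site is
  charged through `≤ 2` ring sites of its parent sheet, backward determinism of rows).
* `stub_dr5_childBootstrap` — pure real analysis: `f(ρ) ≤ C₁(1+ρ+κW)³/W + f(ρ+κW)/4` with the cubic a-priori bound
  iterates to `f(ρ) ≤ 128 C₁ ρ³/W`, hence `≤ θρ³` eventually.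

COMPOSITION `FiveFoldRation_of`: definitional reading of the crux (`fiveFoldRation_iff_axisCount`) + landed
`frontEnd_of_isAdmissible` + the three local stubs (⇒ `SheetAxioms`) + engine (⇒ `StripForest`) + wide/narrow
(⇒ `ChildLayerInequality`, glue `childLayerInequality_of`) + landed `stub_dr5_cubic` (finiteness ⇒ monotone profile,
cubic bound) + bootstrap.  Sorries: exactly the seven stubs.

Disproof used: `Cruxes/FiveFoldRation/Disproof.lean` cycles 1–2 — (b) nothing metric is asserted in real
coordinates (rows, sheets, columns are combinatorial; widths are counted in sites; only `|step| ≤ 13/10·d ≤ C R₁` is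
used to place row sites in balls); (a″) constants depend on `S` (through `R₁`, `C₀`); (b′) closed columns are
columns like any other (no injectivity of columns is used); (e′) the engine stub is the card's no-strip-cycle, not a
curvature comparison.  Numerics: `numerics/rodcomb.py` (lead folder) checks (A1)–(A7) on the ideal decahedral rod.
-/

namespace Summit.AtomisticToContinuum.Crystallization.Cruxes.FiveFoldRation.Sketch

open Summit.AtomisticToContinuum.Crystallization.Theorems
open Summit.AtomisticToContinuum.Crystallization.Theorems.FiveFoldRation

/-! ## The seven stubs of v7 -/

/-- **(A1)–(A4) layers read off links (fcc and hcp frames).** (A1) an fcc-like site has no equatorial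
shell-mate (every edge of the cuboctahedral link lies in exactly one link triangle); (A2) at an hcp-like site every
equatorial shell-mate has a unique straight continuation (its antipode in the in-layer hexagon); (A3) an hcp-like
site has at most six equatorial shell-mates (the hexagon); (A4) none of them is fcc-like (the common neighbours of an
hcp-like site and an in-layer neighbour contain a 2-path, impossible around a vertex of a cuboctahedral link, whose
vertex figure is a perfect matching).  Finite combinatorics of `fccInt` / `hcpInt` by `decide`, transferred through
the landed links lemma (`FrontEnd S`: `LinksArePatterns S`) and shell symmetry. -/
theorem stub_dr5_eqPattern : ∀ δ : ℝ, 0 < δ → ∀ S : Set (EuclideanSpace ℝ (Fin 3)), Summit.AtomisticToContinuum.Crystallization.Theorems.FiveFoldRation.IsAdmissible δ S → Summit.AtomisticToContinuum.Crystallization.Theorems.FiveFoldRation.FrontEnd S → (∀ x p : EuclideanSpace ℝ (Fin 3), Summit.AtomisticToContinuum.Crystallization.Theorems.FiveFoldRation.IsFccLike S x → ¬ Summit.AtomisticToContinuum.Crystallization.Theorems.FiveFoldRation.Equatorial S x p) ∧ (∀ x p : EuclideanSpace ℝ (Fin 3), Summit.AtomisticToContinuum.Crystallization.Theorems.FiveFoldRation.IsHcpLike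 S x → Summit.AtomisticToContinuum.Crystallization.Theorems.FiveFoldRation.Equatorial S x p → ∃ q : EuclideanSpace ℝ (Fin 3), Summit.AtomisticToContinuum.Crystallization.Theorems.FiveFoldRation.Straight S x p q ∧ ∀ q' : EuclideanSpace ℝ (Fin 3), Summit.AtomisticToContinuum.Crystallization.Theorems.FiveFoldRation.Straight S x p q' → q' = q) ∧ (∀ x : EuclideanSpace ℝ (Fin 3), Summit.AtomisticToContinuum.Crystallization.Theorems.FiveFoldRation.IsHcpLike S x → ∃ h : Fin 6 → EuclideanSpace ℝ (Fin 3), ∀ p : EuclideanSpace ℝ (Fin 3), Summit.AtomisticToContinuum.Crystallization.Theorems.FiveFoldRation.Equatorial S x p → ∃ i : Fin 6, h i = p) ∧ (∀ x p : EuclideanSpace ℝ (Fin 3), Summit.AtomisticToContinuum.Crystallization.Theorems.FiveFoldRation.IsHcpLike S x → Summit.AtomisticToContinuum.Crystallization.Theorems.FiveFoldRation.Equatorial S x p → ¬ Summit.AtomisticToContinuum.Crystallization.Theorems.FiveFoldRation.IsFccLike S p) := by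
  sorry

/-- **(A5), (A7) the ring of an axis site (deca frame).** A non-axis shell-mate `t` of an axis site `y` (a ring
site: poles are axis sites by the landed pole lemma) sees `y` in its layer — the link edge `(y, pole)` of `t` lies
in the two link triangles through the neighbouring ring sites `r(k±1, σ)` (chord `1.018 ≤ 26/25`); and `y` has ten
distinct ring sites, none of them an axis site (a deca-matched ring site `t` would make the pole `p` of `y` a pole of
`t`, 5-valent in the link of `t`, while `t` is a ring image in the deca frame of `p`, 4-valent — contradiction). -/
theorem stub_dr5_eqRing : ∀ δ : ℝ, 0 < δ → ∀ S : Set (EuclideanSpace ℝ (Fin 3)), Summit.AtomisticToContinuum.Crystallization.Theorems.FiveFoldRation.IsAdmissible δ S → Summit.AtomisticToContinuum.Crystallization.Theorems.FiveFoldRation.FrontEnd S → (∀ y t : EuclideanSpace ℝ (Fin 3), y ∈ Summit.AtomisticToContinuum.Crystallization.Theorems.FiveFoldRation.axisSites S → t ∈ Summit.AtomisticToContinuum.Crystallization.Theorems.FiveFoldRation.firstShell S y → t ∉ Summit.AtomisticToContinuum.Crystallization.Theorems.FiveFoldRation.axisSites S → Summit.AtomisticToContinuum.Crystallization.Theorems.FiveFoldRation.Equatorial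 S t y) ∧ (∀ y : EuclideanSpace ℝ (Fin 3), y ∈ Summit.AtomisticToContinuum.Crystallization.Theorems.FiveFoldRation.axisSites S → ∃ g : Fin 10 → EuclideanSpace ℝ (Fin 3), Function.Injective g ∧ ∀ i : Fin 10, g i ∈ Summit.AtomisticToContinuum.Crystallization.Theorems.FiveFoldRation.firstShell S y ∧ g i ∉ Summit.AtomisticToContinuum.Crystallization.Theorems.FiveFoldRation.axisSites S) := by
  sorry

/-- **(A6) one fan partner.** Among the ring sites of an axis site `y`, a ring site `t = r(k, σ)` has at most one
in-layer (`Equatorial`) partner, namely `r(k, −σ)`: the deca-neighbours of `t` among the rings are `r(k±1, σ)` and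
`r(k, −σ)`; in the frame of `t` (hcp-like: an fcc-like `t` has no equatorial shell-mate at all, yet `y` is one) the
four common neighbours of `t` and `y` carry a 2-path centred at the pole, which identifies `r(k±1, σ)` as the two APEX
neighbours of the equatorial vertex `y` — not in the hexagon, hence not equatorial for `t`. -/
theorem stub_dr5_fanPartner : ∀ δ : ℝ, 0 < δ → ∀ S : Set (EuclideanSpace ℝ (Fin 3)), Summit.AtomisticToContinuum.Crystallization.Theorems.FiveFoldRation.IsAdmissible δ S → Summit.AtomisticToContinuum.Crystallization.Theorems.FiveFoldRation.FrontEnd S → ∀ y t t' t'' : EuclideanSpace ℝ (Fin 3), y ∈ Summit.AtomisticToContinuum.Crystallization.Theorems.FiveFoldRation.axisSites S → t ∈ Summit.AtomisticToContinuum.Crystallization.Theorems.FiveFoldRation.firstShell S y → t ∉ Summit.AtomisticToContinuum.Crystallization.Theorems.FiveFoldRation.axisSites S → t' ∈ Summit.AtomisticToContinuum.Crystallization.Theorems.FiveFoldRation.firstShell S y → t' ∉ Summit.AtomisticToContinuum.Crystallization.Theorems.FiveFoldRation.axisSites S → t'' ∈ Summit.AtomisticToContinuum.Crystallization.Theorems.FiveFoldRation.firstShell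 S y → t'' ∉ Summit.AtomisticToContinuum.Crystallization.Theorems.FiveFoldRation.axisSites S → t' ≠ t → t'' ≠ t → Summit.AtomisticToContinuum.Crystallization.Theorems.FiveFoldRation.Equatorial S t t' → Summit.AtomisticToContinuum.Crystallization.Theorems.FiveFoldRation.Equatorial S t t'' → t' = t'' := by
  sorry

/-- **THE ENGINE (global, crux-sized): the strip forest.** For admissible `S` with the landed front end and the
local sheet axioms, the column–sheet incidence structure has no flat tube: `StripForest S`.  Intended proof: the
ideal octet complex `K(S)` is a flat cone 3-manifold homeomorphic (by the locally `1/20`-bi-Lipschitz site map, a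
proper local homeomorphism onto simply connected `ℝ³`) to `ℝ³`; a strip cycle glues to a properly embedded flat
cylinder bounding a tube; innermost tubes are flat inside and develop isometrically, so the perpendicular
cross-section is a closed planar polygon with exterior angles `π − k_i·arccos(1/3)`, contradicting
`arccos(1/3)/π ∉ ℚ` (`TetrahedralFrustration.nat_mul_tetDihedralAngle_ne`); inner axes are handled by descent.
Registered as ONE typed target; expected to be promoted to an item of its own. -/
theorem stub_dr5_engine : ∀ δ : ℝ, 0 < δ → ∀ S : Set (EuclideanSpace ℝ (Fin 3)), Summit.AtomisticToContinuum.Crystallization.Theorems.FiveFoldRation.IsAdmissible δ S → Summit.AtomisticToContinuum.Crystallization.Theorems.FiveFoldRation.FrontEnd S → Summit.AtomisticToContinuum.Crystallization.Theorems.FiveFoldRation.SheetAxioms S → Summit.AtomisticToContinuum.Crystallization.Theorems.FiveFoldRation.StripForest S := by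
  sorry

/-- **AREA (wide axis sites).** With `κ, C` depending on `S` only: the axis sites of `B̄_ρ(c)` that are NOT
`W`-narrow number at most `C(1+ρ+κW)³/W` (`W ≥ 1`, `ρ ≥ 0`).  Each such site owns a row of `≥ W` non-axis sites
within distance `κW`; the map (site, ring, step) ↦ row site has fibres `≤ 6` (an hcp-like site has `≤ 6` in-layer
neighbours and a row is determined backwards by its last in-layer edge, (A2)); volume by `stub_dr5_cubic`. -/
theorem stub_dr5_wide : ∀ δ : ℝ, 0 < δ → ∀ S : Set (EuclideanSpace ℝ (Fin 3)), Summit.AtomisticToContinuum.Crystallization.Theorems.FiveFoldRation.IsAdmissible δ S → Summit.AtomisticToContinuum.Crystallization.Theorems.FiveFoldRation.FrontEnd S → Summit.AtomisticToContinuum.Crystallization.Theorems.FiveFoldRation.SheetAxioms S → ∃ C κ : ℝ, 0 ≤ κ ∧ ∀ c : EuclideanSpace ℝ (Fin 3), ∀ W ρ : ℝ, 1 ≤ W → 0 ≤ ρ → (({a : EuclideanSpace ℝ (Fin 3) | a ∈ Summit.AtomisticToContinuum.Crystallization.Theorems.FiveFoldRation.axisSites S ∧ ¬ Summit.AtomisticToContinuum.Crystallization.Theorems.FiveFoldRation.IsNarrow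 W S a} ∩ Metric.closedBall c ρ).ncard : ℝ) ≤ C * (1 + ρ + κ * W) ^ 3 / W := by
  sorry

/-- **FOREST CHARGING (narrow axis sites).** With `κ` depending on `S` only: given the strip forest, the
`W`-narrow axis sites of `B̄_ρ(c)` number at most a quarter of the axis sites of `B̄_{ρ+κW}(c)`.  A narrow site has
ten short rows (A7), at most two of them in its column's parent sheet ((F1)+(A6)), so `≥ 8` end at sites of child
columns ((F2), (F3)); an end site is charged only through the `≤ 2` ring sites of its own parent sheet and, given the
ring site, by at most one row (backward determinism, (A2)). Hence `8·narrow(ρ) ≤ 2·f(ρ + κW)`. -/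
theorem stub_dr5_narrow : ∀ δ : ℝ, 0 < δ → ∀ S : Set (EuclideanSpace ℝ (Fin 3)), Summit.AtomisticToContinuum.Crystallization.Theorems.FiveFoldRation.IsAdmissible δ S → Summit.AtomisticToContinuum.Crystallization.Theorems.FiveFoldRation.FrontEnd S → Summit.AtomisticToContinuum.Crystallization.Theorems.FiveFoldRation.SheetAxioms S → Summit.AtomisticToContinuum.Crystallization.Theorems.FiveFoldRation.StripForest S → ∃ κ : ℝ, 0 ≤ κ ∧ ∀ c : EuclideanSpace ℝ (Fin 3), ∀ W ρ : ℝ, 1 ≤ W → 0 ≤ ρ → (({a : EuclideanSpace ℝ (Fin 3) | Summit.AtomisticToContinuum.Crystallization.Theorems.FiveFoldRation.IsNarrow W S a} ∩ Metric.closedBall c ρ).ncard : ℝ) ≤ Summit.AtomisticToContinuum.Crystallization.Theorems.FiveFoldRation.axisCount S c (ρ + κ * W) / 4 := by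
  sorry

/-- **BOOTSTRAP (pure real analysis, uniform in the profile).** If `f` is monotone, non-negative, `≤ C₀(1+r)³`,
and satisfies the child layer inequality `f(ρ) ≤ C₁(1+ρ+κW)³/W + f(ρ+κW)/4` for all `W ≥ 1`, `ρ ≥ 0`, then
`f(ρ) ≤ θρ³` for `ρ ≥ ρ₀(C₀, C₁, κ, θ)`: iterate `n` times (geometric series `Σ 4^{-i}(i+3)³ ≤ 128`), then choose
`W` and `n` large. -/
theorem stub_dr5_childBootstrap : ∀ C₀ C₁ κ θ : ℝ, 0 ≤ κ → 0 < θ → ∃ ρ₀ : ℝ, ∀ f : ℝ → ℝ, Monotone f → (∀ r : ℝ, 0 ≤ f r) → (∀ r : ℝ, 0 ≤ r → f r ≤ C₀ * (1 + r) ^ 3) → (∀ W ρ : ℝ, 1 ≤ W → 0 ≤ ρ → f ρ ≤ C₁ * (1 + ρ + κ * W) ^ 3 / W + f (ρ + κ * W) / 4) → ∀ ρ : ℝ, ρ₀ ≤ ρ → f ρ ≤ θ * ρ ^ 3 := by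
  sorry

/-! ## Statements of the stubs (verbatim copies, for the assembly-by-name) -/

/-- Statement of `stub_dr5_eqPattern` (verbatim). -/
def Sig.eqPattern : Prop := ∀ δ : ℝ, 0 < δ → ∀ S : Set (EuclideanSpace ℝ (Fin 3)), IsAdmissible δ S → FrontEnd S → (∀ x p : EuclideanSpace ℝ (Fin 3), IsFccLike S x → ¬ Equatorial S x p) ∧ (∀ x p : EuclideanSpace ℝ (Fin 3), IsHcpLike S x → Equatorial S x p → ∃ q : EuclideanSpace ℝ (Fin 3), Straight S x p q ∧ ∀ q' : EuclideanSpace ℝ (Fin 3), Straight S x p q' → q' = q) ∧ (∀ x : EuclideanSpace ℝ (Fin 3), IsHcpLike S x → ∃ h : Fin 6 → EuclideanSpace ℝ (Fin 3), ∀ p : EuclideanSpace ℝ (Fin 3), Equatorial S x p → ∃ i : Fin 6, h i = p) ∧ (∀ x p : EuclideanSpace ℝ (Fin 3), IsHcpLike S x → Equatorial S x p → ¬ IsFccLike S p)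
/-- Statement of `stub_dr5_eqRing` (verbatim). -/
def Sig.eqRing : Prop := ∀ δ : ℝ, 0 < δ → ∀ S : Set (EuclideanSpace ℝ (Fin 3)), IsAdmissible δ S → FrontEnd S → (∀ y t : EuclideanSpace ℝ (Fin 3), y ∈ axisSites S → t ∈ firstShell S y → t ∉ axisSites S → Equatorial S t y) ∧ (∀ y : EuclideanSpace ℝ (Fin 3), y ∈ axisSites S → ∃ g : Fin 10 → EuclideanSpace ℝ (Fin 3), Function.Injective g ∧ ∀ i : Fin 10, g i ∈ firstShell S y ∧ g i ∉ axisSites S)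
/-- Statement of `stub_dr5_fanPartner` (verbatim). -/
def Sig.fanPartner : Prop := ∀ δ : ℝ, 0 < δ → ∀ S : Set (EuclideanSpace ℝ (Fin 3)), IsAdmissible δ S → FrontEnd S → ∀ y t t' t'' : EuclideanSpace ℝ (Fin 3), y ∈ axisSites S → t ∈ firstShell S y → t ∉ axisSites S → t' ∈ firstShell S y → t' ∉ axisSites S → t'' ∈ firstShell S y → t'' ∉ axisSites S → t' ≠ t → t'' ≠ t → Equatorial S t t' → Equatorial S t t'' → t' = t''
/-- Statement of `stub_dr5_engine` (verbatim). -/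
def Sig.engine : Prop := ∀ δ : ℝ, 0 < δ → ∀ S : Set (EuclideanSpace ℝ (Fin 3)), IsAdmissible δ S → FrontEnd S → SheetAxioms S → StripForest S
/-- Statement of `stub_dr5_wide` (verbatim). -/
def Sig.wide : Prop := ∀ δ : ℝ, 0 < δ → ∀ S : Set (EuclideanSpace ℝ (Fin 3)), IsAdmissible δ S → FrontEnd S → SheetAxioms S → ∃ C κ : ℝ, 0 ≤ κ ∧ ∀ c : EuclideanSpace ℝ (Fin 3), ∀ W ρ : ℝ, 1 ≤ W → 0 ≤ ρ → (({a : EuclideanSpace ℝ (Fin 3) | a ∈ axisSites S ∧ ¬ IsNarrow W S a} ∩ Metric.closedBall c ρ).ncard : ℝ) ≤ C * (1 + ρ + κ * W) ^ 3 / W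
/-- Statement of `stub_dr5_narrow` (verbatim). -/
def Sig.narrow : Prop := ∀ δ : ℝ, 0 < δ → ∀ S : Set (EuclideanSpace ℝ (Fin 3)), IsAdmissible δ S → FrontEnd S → SheetAxioms S → StripForest S → ∃ κ : ℝ, 0 ≤ κ ∧ ∀ c : EuclideanSpace ℝ (Fin 3), ∀ W ρ : ℝ, 1 ≤ W → 0 ≤ ρ → (({a : EuclideanSpace ℝ (Fin 3) | IsNarrow W S a} ∩ Metric.closedBall c ρ).ncard : ℝ) ≤ axisCount S c (ρ + κ * W) / 4
/-- Statement of `stub_dr5_childBootstrap` (verbatim). -/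
def Sig.childBootstrap : Prop := ∀ C₀ C₁ κ θ : ℝ, 0 ≤ κ → 0 < θ → ∃ ρ₀ : ℝ, ∀ f : ℝ → ℝ, Monotone f → (∀ r : ℝ, 0 ≤ f r) → (∀ r : ℝ, 0 ≤ r → f r ≤ C₀ * (1 + r) ^ 3) → (∀ W ρ : ℝ, 1 ≤ W → 0 ≤ ρ → f ρ ≤ C₁ * (1 + ρ + κ * W) ^ 3 / W + f (ρ + κ * W) / 4) → ∀ ρ : ℝ, ρ₀ ≤ ρ → f ρ ≤ θ * ρ ^ 3

/-! ## Glue -/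

/-- The three local stubs give `SheetAxioms S`. -/
theorem sheetAxioms_of (h1 : Sig.eqPattern) (h2 : Sig.eqRing) (h3 : Sig.fanPartner) {δ : ℝ} (hδ : 0 < δ)
    {S : Set E3} (hS : IsAdmissible δ S) (hF : FrontEnd S) : SheetAxioms S := by
  obtain ⟨a1, a2, a3, a4⟩ := h1 δ hδ S hS hF
  obtain ⟨a5, a7⟩ := h2 δ hδ S hS hF
  exact ⟨a1, a2, a3, a4, a5, h3 δ hδ S hS hF, a7⟩

/-- Wide + narrow give the child layer inequality (narrow ∪ wide = all axis sites; common `κ := max κ₁ κ₂` by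
monotonicity of the profile, which needs only finiteness of `S` in balls). -/
theorem childLayerInequality_of (hw : Sig.wide) (hn : Sig.narrow) {δ : ℝ} (hδ : 0 < δ) {S : Set E3}
    (hS : IsAdmissible δ S) (hF : FrontEnd S) (hA : SheetAxioms S) (hT : StripForest S) :
    ChildLayerInequality S := by
  obtain ⟨C, κ₁, hκ₁, hwide⟩ := hw δ hδ S hS hF hA
  obtain ⟨κ₂, hκ₂, hnarrow⟩ := hn δ hδ S hS hF hA hT
  obtain ⟨hfin, -, -⟩ := stub_dr5_cubic δ hδ S hS.1
  have hAxS : axisSites S ⊆ S := fun y hy => hy.1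
  have hfinA : ∀ (c : E3) (r : ℝ), (axisSites S ∩ Metric.closedBall c r).Finite := fun c r =>
    (hfin c r).subset (Set.inter_subset_inter_left _ hAxS)
  have hmono : ∀ c : E3, Monotone (axisCount S c) := by
    intro c r r' hrr'
    simp only [axisCount]
    exact_mod_cast Set.ncard_le_ncard
      (Set.inter_subset_inter_right _ (Metric.closedBall_subset_closedBall hrr')) (hfinA c r')
  refine ⟨max C 0, max κ₁ κ₂, le_max_of_le_left hκ₁, fun c W ρ hW hρ => ?_⟩
  have hW0 : (0 : ℝ) ≤ W := le_trans zero_le_one hW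
  -- split the axis sites of the ball into narrow and non-narrow ones
  have hsplit : axisSites S ∩ Metric.closedBall c ρ ⊆
      ({a : E3 | IsNarrow W S a} ∩ Metric.closedBall c ρ) ∪
        ({a : E3 | a ∈ axisSites S ∧ ¬ IsNarrow W S a} ∩ Metric.closedBall c ρ) := by
    intro a ha
    by_cases hna : IsNarrow W S a
    · exact Or.inl ⟨hna, ha.2⟩
    · exact Or.inr ⟨⟨ha.1, hna⟩, ha.2⟩
  have hfinN : ({a : E3 | IsNarrow W S a} ∩ Metric.closedBall c ρ).Finite :=
    (hfinA c ρ).subset (fun a ha => ⟨ha.1.1, ha.2⟩)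
  have hfinW : ({a : E3 | a ∈ axisSites S ∧ ¬ IsNarrow W S a} ∩ Metric.closedBall c ρ).Finite :=
    (hfinA c ρ).subset (fun a ha => ⟨ha.1.1, ha.2⟩)
  have hcount : axisCount S c ρ ≤ (({a : E3 | IsNarrow W S a} ∩ Metric.closedBall c ρ).ncard : ℝ) +
      (({a : E3 | a ∈ axisSites S ∧ ¬ IsNarrow W S a} ∩ Metric.closedBall c ρ).ncard : ℝ) := by
    simp only [axisCount]
    have h1 := Set.ncard_le_ncard hsplit (hfinN.union hfinW)
    have h2 := Set.ncard_union_le ({a : E3 | IsNarrow W S a} ∩ Metric.closedBall c ρ)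
      ({a : E3 | a ∈ axisSites S ∧ ¬ IsNarrow W S a} ∩ Metric.closedBall c ρ)
    exact_mod_cast h1.trans h2
  have hwide' := hwide c W ρ hW hρ
  have hnarrow' := hnarrow c W ρ hW hρ
  -- compare the two κ's with their max
  have hk1 : C * (1 + ρ + κ₁ * W) ^ 3 / W ≤ max C 0 * (1 + ρ + max κ₁ κ₂ * W) ^ 3 / W := by
    have hb0 : 0 ≤ 1 + ρ + κ₁ * W := by positivity
    have hb : (1 + ρ + κ₁ * W) ^ 3 ≤ (1 + ρ + max κ₁ κ₂ * W) ^ 3 := by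
      refine pow_le_pow_left₀ hb0 ?_ 3
      have := mul_le_mul_of_nonneg_right (le_max_left κ₁ κ₂) hW0
      linarith
    have hW' : 0 < W := lt_of_lt_of_le zero_lt_one hW
    rw [div_le_div_iff_of_pos_right hW']
    calc C * (1 + ρ + κ₁ * W) ^ 3 ≤ max C 0 * (1 + ρ + κ₁ * W) ^ 3 :=
          mul_le_mul_of_nonneg_right (le_max_left C 0) (pow_nonneg hb0 3)
      _ ≤ max C 0 * (1 + ρ + max κ₁ κ₂ * W) ^ 3 := mul_le_mul_of_nonneg_left hb (le_max_right C 0)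
  have hk2 : axisCount S c (ρ + κ₂ * W) / 4 ≤ axisCount S c (ρ + max κ₁ κ₂ * W) / 4 := by
    have : ρ + κ₂ * W ≤ ρ + max κ₁ κ₂ * W := by
      have := mul_le_mul_of_nonneg_right (le_max_right κ₁ κ₂) hW0
      linarith
    have := hmono c this
    linarith
  linarith

/-! ## Assembly -/

/-- **Assembly**: the seven stubs BY NAME ⇒ the route decl `DisclinationRation.FiveFoldRation` by name. -/
theorem FiveFoldRation_of (h1 : Sig.eqPattern) (h2 : Sig.eqRing) (h3 : Sig.fanPartner) (h4 : Sig.engine) (h5 : Sig.wide)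
    (h6 : Sig.narrow) (h7 : Sig.childBootstrap) :
    Summit.AtomisticToContinuum.Crystallization.Theses.DisclinationRation.FiveFoldRation := by
  rw [fiveFoldRation_iff_axisCount]
  intro δ hδ S hS θ hθ
  have hF : FrontEnd S := frontEnd_of_isAdmissible hδ hS
  have hA : SheetAxioms S := sheetAxioms_of h1 h2 h3 hδ hS hF
  have hT : StripForest S := h4 δ hδ S hS hF hA
  obtain ⟨C₁, κ, hκ, hchild⟩ := childLayerInequality_of h5 h6 hδ hS hF hA hT
  obtain ⟨hfin, C₀, hcub⟩ := stub_dr5_cubic δ hδ S hS.1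
  obtain ⟨ρ₀, hρ₀⟩ := h7 C₀ C₁ κ θ hκ hθ
  refine ⟨ρ₀, fun L hL c => ?_⟩
  have hAxS : axisSites S ⊆ S := fun y hy => hy.1
  have hfinA : ∀ r : ℝ, (axisSites S ∩ Metric.closedBall c r).Finite := fun r =>
    (hfin c r).subset (Set.inter_subset_inter_left _ hAxS)
  have hmono : Monotone (axisCount S c) := by
    intro r r' hrr'
    simp only [axisCount]
    exact_mod_cast Set.ncard_le_ncard
      (Set.inter_subset_inter_right _ (Metric.closedBall_subset_closedBall hrr')) (hfinA r')
  have hnn : ∀ r, 0 ≤ axisCount S c r := fun r => by simp only [axisCount]; exact Nat.cast_nonneg _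
  have hcub' : ∀ r, 0 ≤ r → axisCount S c r ≤ C₀ * (1 + r) ^ 3 := by
    intro r hr
    refine le_trans ?_ (hcub c r hr)
    simp only [axisCount]
    exact_mod_cast Set.ncard_le_ncard (Set.inter_subset_inter_left _ hAxS) (hfin c r)
  exact hρ₀ (axisCount S c) hmono hnn hcub' (fun W r hW hr => hchild c W r hW hr) L hL

/-- **The registered skeleton in one line**: the declared stubs fed into `FiveFoldRation_of` prove the crux by
name, modulo exactly their `sorry`s. -/
theorem FiveFoldRation_proof :
    Summit.AtomisticToContinuum.Crystallization.Theses.DisclinationRation.FiveFoldRation :=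
  FiveFoldRation_of stub_dr5_eqPattern stub_dr5_eqRing stub_dr5_fanPartner stub_dr5_engine stub_dr5_wide
    stub_dr5_narrow stub_dr5_childBootstrap

end Summit.AtomisticToContinuum.Crystallization.Cruxes.FiveFoldRation.Sketch
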